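import Summits.Ventures.PercRepro.C026ThreeGadget
import Summits.Ventures.PercRepro.C026ThreePlanesF2
import Summits.Ventures.PercRepro.C026FactorTwo

/-!
# Bit-planes for the 6-vertex gadget, VI: the factor-2 form (p5, gen 13)

mine-3's S8 `FactorTwoDFree` (`2·#KL ≤ #Kc + #Lc`) on every multigraph supported on six vertices with every
edge at a non-mark, from the factor-2 kernel table of `C026ThreePlanesF2` by the same counting as the
gadget theorem (`card_filter_state`, cells, `fib_eq_of_sameCell`).
-/

namespace PercRepro

namespace MultiGraph

open PairModel Plane6

section FactorTwo

variable {V E : Type*} {G : MultiGraph V E} {ι : ℕ → V}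

/-- The value of `[0, x]` at `t`: twice the bit. -/
theorem valAt_double (x t : ℕ) : valAt [0, x] t = 2 * (x.testBit t).toNat := by
  simp [valAt]

/-- The value of `[x ⊕ y, x ∧ y]` at `t`: the sum of the two bits. -/
theorem valAt_pair (x y t : ℕ) : valAt [x ^^^ y, x &&& y] t = (x.testBit t).toNat + (y.testBit t).toNat := by
  simp only [valAt, Nat.testBit_xor, Nat.testBit_and]
  rcases Bool.eq_false_or_eq_true (x.testBit t) with h1 | h1 <;>
    rcases Bool.eq_false_or_eq_true (y.testBit t) with h2 | h2 <;> simp [h1, h2]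

/-- Under `bot`, `BadM` is the H-connection `a ~_H b`. -/
theorem badM_iff_of_isBot {ω : Config E} {a b c : V} (hbot : G.IsBot ω a b c) :
    G.BadM ω a b c ↔ G.HConn ω c a b := by
  unfold BadM
  rw [conn_kSwap_iff_hConn]
  exact ⟨fun h => h.2, fun h => ⟨⟨hbot.2.1, hbot.2.2⟩, h⟩⟩

/-- Under `bot`, the first offer is `c ~_H a` avoiding `L`. -/
theorem o1_iff_of_isBot {ω : Config E} {a b c : V} (hbot : G.IsBot ω a b c) :
    G.O1 ω a b c ↔ G.HConnAvoid ω c (G.cluster ω b) c a :=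
  ⟨fun h => (G.cellAC_kSwapSealed_iff hbot).1 h.2, fun h => ⟨hbot, (G.cellAC_kSwapSealed_iff hbot).2 h⟩⟩

/-- Under `bot`, the second offer is `c ~_H b` avoiding `K`. -/
theorem o2_iff_of_isBot {ω : Config E} {a b c : V} (hbot : G.IsBot ω a b c) :
    G.O2 ω a b c ↔ G.HConnAvoid ω c (G.cluster ω a) c b :=
  ⟨fun h => (G.cellBC_kSwapSealed_iff hbot).1 h.2, fun h => ⟨hbot, (G.cellBC_kSwapSealed_iff hbot).2 h⟩⟩

variable (hinj : InjBelow ι 6)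
variable (hnm : ∀ e, ∃ k, 3 ≤ k ∧ k < 6 ∧ (G.fst e = ι k ∨ G.snd e = ι k))
variable (hsup : G.Supported ι 6)
include hinj hnm hsup

/-- `KL` of a configuration is the `KL` bit of its state. -/
theorem kl_iff_bit (ω : Config E) :
    G.KL ω (ι 0) (ι 1) (ι 2) ↔ (bot &&& BAD &&& notP o1 &&& notP o2).testBit (G.stateOf (ι := ι) ω) = true := by
  have hs := stateOf_lt (G := G) (ι := ι) ω
  rw [Nat.testBit_and, Nat.testBit_and, Nat.testBit_and, testBit_notP hs, testBit_notP hs,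
    Bool.and_eq_true, Bool.and_eq_true, Bool.and_eq_true, Bool.not_eq_true', Bool.not_eq_true']
  unfold KL BotM
  rw [conn_kSwap_iff_hConn, isBot_iff_bit hinj hnm hsup, hConn_iff_bit hinj hnm hsup]
  constructor
  · rintro ⟨⟨hb, hB⟩, h1, h2⟩
    have hbot := (isBot_iff_bit hinj hnm hsup ω).2 hb
    refine ⟨⟨⟨hb, hB⟩, ?_⟩, ?_⟩
    · rcases Bool.eq_false_or_eq_true (o1.testBit (G.stateOf (ι := ι) ω)) with h | h
      · exact absurd ((o1_iff_of_isBot hbot).2 ((o1_iff_bit hinj hnm hsup ω).2 h)) h1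
      · exact h
    · rcases Bool.eq_false_or_eq_true (o2.testBit (G.stateOf (ι := ι) ω)) with h | h
      · exact absurd ((o2_iff_of_isBot hbot).2 ((o2_iff_bit hinj hnm hsup ω).2 h)) h2
      · exact h
  · rintro ⟨⟨⟨hb, hB⟩, h1⟩, h2⟩
    have hbot := (isBot_iff_bit hinj hnm hsup ω).2 hb
    refine ⟨⟨hb, hB⟩, ?_, ?_⟩
    · intro ho
      have := (o1_iff_bit hinj hnm hsup ω).1 ((o1_iff_of_isBot hbot).1 ho)
      rw [this] at h1; exact absurd h1 (by decide)
    · intro ho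
      have := (o2_iff_bit hinj hnm hsup ω).1 ((o2_iff_of_isBot hbot).1 ho)
      rw [this] at h2; exact absurd h2 (by decide)

/-- `Kc` of a configuration is the `Kc` bit of its state. -/
theorem kc_iff_bit (ω : Config E) :
    G.Kc ω (ι 0) (ι 1) (ι 2) ↔ (bot &&& notP BAD &&& o1).testBit (G.stateOf (ι := ι) ω) = true := by
  have hs := stateOf_lt (G := G) (ι := ι) ω
  rw [Nat.testBit_and, Nat.testBit_and, testBit_notP hs, Bool.and_eq_true, Bool.and_eq_true, Bool.not_eq_true']
  unfold Kc
  constructor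
  · rintro ⟨hbot, hB, ho⟩
    refine ⟨⟨(isBot_iff_bit hinj hnm hsup ω).1 hbot, ?_⟩, (o1_iff_bit hinj hnm hsup ω).1 ((o1_iff_of_isBot hbot).1 ho)⟩
    rcases Bool.eq_false_or_eq_true (BAD.testBit (G.stateOf (ι := ι) ω)) with h | h
    · exact absurd ((badM_iff_of_isBot hbot).2 ((hConn_iff_bit hinj hnm hsup ω).2 h)) hB
    · exact h
  · rintro ⟨⟨hb, hB⟩, ho⟩
    have hbot := (isBot_iff_bit hinj hnm hsup ω).2 hb
    refine ⟨hbot, fun hbad => ?_, (o1_iff_of_isBot hbot).2 ((o1_iff_bit hinj hnm hsup ω).2 ho)⟩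
    have := (hConn_iff_bit hinj hnm hsup ω).1 ((badM_iff_of_isBot hbot).1 hbad)
    rw [this] at hB; exact absurd hB (by decide)

/-- `Lc` of a configuration is the `Lc` bit of its state. -/
theorem lc_iff_bit (ω : Config E) :
    G.Lc ω (ι 0) (ι 1) (ι 2) ↔ (bot &&& notP BAD &&& o2).testBit (G.stateOf (ι := ι) ω) = true := by
  have hs := stateOf_lt (G := G) (ι := ι) ω
  rw [Nat.testBit_and, Nat.testBit_and, testBit_notP hs, Bool.and_eq_true, Bool.and_eq_true, Bool.not_eq_true']
  unfold Lc
  constructor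
  · rintro ⟨hbot, hB, ho⟩
    refine ⟨⟨(isBot_iff_bit hinj hnm hsup ω).1 hbot, ?_⟩, (o2_iff_bit hinj hnm hsup ω).1 ((o2_iff_of_isBot hbot).1 ho)⟩
    rcases Bool.eq_false_or_eq_true (BAD.testBit (G.stateOf (ι := ι) ω)) with h | h
    · exact absurd ((badM_iff_of_isBot hbot).2 ((hConn_iff_bit hinj hnm hsup ω).2 h)) hB
    · exact h
  · rintro ⟨⟨hb, hB⟩, ho⟩
    have hbot := (isBot_iff_bit hinj hnm hsup ω).2 hb
    refine ⟨hbot, fun hbad => ?_, (o2_iff_of_isBot hbot).2 ((o2_iff_bit hinj hnm hsup ω).2 ho)⟩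
    have := (hConn_iff_bit hinj hnm hsup ω).1 ((badM_iff_of_isBot hbot).1 hbad)
    rw [this] at hB; exact absurd hB (by decide)

omit hinj hnm hsup in
/-- Sums over the states regroup by cells. -/
theorem sum_range_eq_sum_cells (g : ℕ → ℕ) : ∑ t ∈ Finset.range NS, g t =
    ∑ s ∈ (Finset.range NS).filter (fun s => valid.testBit s = true), ∑ t ∈ expand 12 s, g t := by
  rw [← Finset.sum_fiberwise_of_maps_to (g := rep) (t := (Finset.range NS).filter fun s => valid.testBit s = true)]
  · apply Finset.sum_congr rfl
    intro s hs
    simp only [Finset.mem_filter, Finset.mem_range] at hs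
    congr 1
    ext t
    simp only [Finset.mem_filter, Finset.mem_range, mem_expand_iff hs.1 hs.2]
    constructor
    · rintro ⟨ht, hr⟩
      refine ⟨ht, sameCell_of_rep_eq ?_⟩
      rw [hr, rep_self hs.1 hs.2]
    · rintro ⟨ht, hc⟩
      refine ⟨ht, ?_⟩
      rw [rep_eq_of_sameCell hc, rep_self hs.1 hs.2]
  · intro t _
    simp only [Finset.mem_filter, Finset.mem_range]
    exact ⟨rep_lt t, rep_valid t⟩

/-- **The factor-2 form on the 6-vertex gadget**: `2·#KL ≤ #Kc + #Lc` on every multigraph supported on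
six vertices with every edge at a non-mark, from the factor-2 kernel table. -/
theorem factorTwo_of_supported6 [Fintype E] [DecidableEq E]
    (htable : ltP (levels 12 [(bot &&& notP BAD &&& o1) ^^^ (bot &&& notP BAD &&& o2),
        (bot &&& notP BAD &&& o1) &&& (bot &&& notP BAD &&& o2)])
      (levels 12 [0, bot &&& BAD &&& notP o1 &&& notP o2]) 0 &&& valid = 0) :
    G.FactorTwoDFree (ι 0) (ι 1) (ι 2) := by
  classical
  unfold FactorTwoDFree
  have e1 : (Finset.univ.filter fun ω : Config E => G.KL ω (ι 0) (ι 1) (ι 2)) =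
      Finset.univ.filter fun ω : Config E =>
        (bot &&& BAD &&& notP o1 &&& notP o2).testBit (G.stateOf (ι := ι) ω) = true := by
    ext ω; simp only [Finset.mem_filter, Finset.mem_univ, true_and, kl_iff_bit hinj hnm hsup]
  have e2 : (Finset.univ.filter fun ω : Config E => G.Kc ω (ι 0) (ι 1) (ι 2)) =
      Finset.univ.filter fun ω : Config E => (bot &&& notP BAD &&& o1).testBit (G.stateOf (ι := ι) ω) = true := by
    ext ω; simp only [Finset.mem_filter, Finset.mem_univ, true_and, kc_iff_bit hinj hnm hsup]
  have e3 : (Finset.univ.filter fun ω : Config E => G.Lc ω (ι 0) (ι 1) (ι 2)) =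
      Finset.univ.filter fun ω : Config E => (bot &&& notP BAD &&& o2).testBit (G.stateOf (ι := ι) ω) = true := by
    ext ω; simp only [Finset.mem_filter, Finset.mem_univ, true_and, lc_iff_bit hinj hnm hsup]
  rw [e1, e2, e3, card_filter_state, card_filter_state, card_filter_state, Finset.mul_sum,
    ← Finset.sum_add_distrib]
  have hm : ∀ t, 2 * (if (bot &&& BAD &&& notP o1 &&& notP o2).testBit t = true then G.fib ι t else 0) =
      G.fib ι t * valAt [0, bot &&& BAD &&& notP o1 &&& notP o2] t := by
    intro t
    rw [valAt_double]
    rcases Bool.eq_false_or_eq_true ((bot &&& BAD &&& notP o1 &&& notP o2).testBit t) with h | h <;> simp [h, mul_comm]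
  have hp : ∀ t, ((if (bot &&& notP BAD &&& o1).testBit t = true then G.fib ι t else 0) +
      (if (bot &&& notP BAD &&& o2).testBit t = true then G.fib ι t else 0)) =
      G.fib ι t * valAt [(bot &&& notP BAD &&& o1) ^^^ (bot &&& notP BAD &&& o2),
        (bot &&& notP BAD &&& o1) &&& (bot &&& notP BAD &&& o2)] t := by
    intro t
    rw [valAt_pair]
    rcases Bool.eq_false_or_eq_true ((bot &&& notP BAD &&& o1).testBit t) with h1 | h1 <;>
      rcases Bool.eq_false_or_eq_true ((bot &&& notP BAD &&& o2).testBit t) with h2 | h2 <;>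
      simp [h1, h2, mul_two]
  simp only [hm, hp]
  rw [sum_range_eq_sum_cells, sum_range_eq_sum_cells]
  apply Finset.sum_le_sum
  intro s hs
  simp only [Finset.mem_filter, Finset.mem_range] at hs
  have hconst : ∀ t ∈ expand 12 s, G.fib ι t = G.fib ι s := by
    intro t ht
    rw [mem_expand_iff hs.1 hs.2] at ht
    exact fib_eq_of_sameCell hinj hsup ht.1 hs.1 ht.2
  have hl : ∑ t ∈ expand 12 s, G.fib ι t * valAt [0, bot &&& BAD &&& notP o1 &&& notP o2] t =
      G.fib ι s * ∑ t ∈ expand 12 s, valAt [0, bot &&& BAD &&& notP o1 &&& notP o2] t := by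
    rw [Finset.mul_sum]; apply Finset.sum_congr rfl; intro t ht; rw [hconst t ht]
  have hr : ∑ t ∈ expand 12 s, G.fib ι t * valAt [(bot &&& notP BAD &&& o1) ^^^ (bot &&& notP BAD &&& o2),
      (bot &&& notP BAD &&& o1) &&& (bot &&& notP BAD &&& o2)] t =
      G.fib ι s * ∑ t ∈ expand 12 s, valAt [(bot &&& notP BAD &&& o1) ^^^ (bot &&& notP BAD &&& o2),
        (bot &&& notP BAD &&& o1) &&& (bot &&& notP BAD &&& o2)] t := by
    rw [Finset.mul_sum]; apply Finset.sum_congr rfl; intro t ht; rw [hconst t ht]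
  rw [hl, hr]
  exact Nat.mul_le_mul_left _ (cell_le_of_ltP_eq_zero htable hs.1 hs.2)


/-- **The factor-2 form on every multigraph with at most three non-marks and no mark–mark edge.** -/
theorem factorTwo_of_supported6' [Fintype E] [DecidableEq E] : G.FactorTwoDFree (ι 0) (ι 1) (ι 2) :=
  factorTwo_of_supported6 hinj hnm hsup Plane6.tableF2

end FactorTwo

end MultiGraph

end PercRepro
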